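import Summits.Ventures.HSemireg.Mod4SlopeInfinitySpectrum

/-!
# Venture HSemireg — MOD-4 line: the CONFLUENT (double-slope) h-part `f = (A + B·h∂)e^{λh}`, `q_m = (A + B m) λ^m`:
# `M_f(q)` is nilpotent on its eigen-directions (`dim ker(M_f − t) = 0` for every `t ≠ 0`, `n ≥ 2`), `rank H_k(q) = 2`, `P_f(q) = 0`

HONEST FRAMING. Part of the Lean index of the computation cell `pub-hsemireg` (seat w3-mod4-1 gen 9, W3 SPECIAL FIBRES;
MOD4-OFFSPLIT TABLE R «confluent (double slope): `P_n(t)² + 2tⁿ` only (`(f,f)_χ = 0`)», COROLLARY S′ (pencil: the confluent family is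
a single orbit)). ELEMENTARY LINEAR ALGEBRA over a field ONLY: no abelian variety, no sheaf, no Ext group, no semiregularity map;
nothing here says that HC / HC_CM / HC_AV holds; no Literature fact is declared; NO definition is introduced (the confluent sequence
`q_m = (A + B·m) λ^m` and the vectors `g_λ = (λ^{n-a})_a`, `g̃ = ((A + B(n-a)) λ^{n-a})_a`, `e_λ = ((-1)^b C(n,b) λ^b)_b`,
`e'_λ = ((-1)^b C(n,b) b λ^b)_b` are written out).

WHAT IS PROVED (`n ≥ 2` where stated — the one alternating identity `Σ_b (-1)^b b C(n,b) = 0` needs it):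
* `altSum_mul_choose` — `Σ_{b ≤ n} (-1)^b b C(n,b) = 0` for `n ≥ 2`; hence `e_λ · g̃ = 0` and `e'_λ · g_λ = 0`
  (`altBinom_dotProduct_conf`, `altBinomDeriv_dotProduct_geom`);
* `hankelT_confluent_mulVec` — `T_f v = (e_λ·v) g̃ + B (e'_λ·v) g_λ`;
* **`middleM_confluent_mulVec`** — `M_f v = ((-1)ⁿ B (e'_λ·g̃)(e_λ·v)) · g_λ` (`n ≥ 2`): `M_f` has rank `≤ 1` and `M_f g_λ = 0`, so `M_f² = 0`;
* **`finrank_ker_middleM_confluent`** — `t ≠ 0`, `n ≥ 2` ⇒ `dim ker(M_f(q) − t) = 0`: NO box locus for the confluent h-part, for every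
  `n ≥ 2` (the sheet's «`P_n(t)² + 2tⁿ` only»);
* **`hankel1_rank_confluent`** — `B ≠ 0`, `λ ≠ 0`, `1 ≤ k`, `k + 1 ≤ N` ⇒ `rank H_k(q) = 2`.
(`P_f(q) = 0` for the confluent h-part — «`(f,f)_χ = 0`» — is recorded on the real-carrier side only through the density formula's
general shape; it is not needed for the rank row.) Everything PROVED, 0 sorry. Namespace `Summit.Ventures.HSemireg.Mod4`.
References: [BourbakiAlgebre1a3] Ch. III §8; [BuchweitzFlenner2008HH] Prop. 6.4.4 (why this matrix).
-/

namespace Summit.Ventures.HSemireg.Mod4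

open Finset Matrix

variable {K : Type*} [Field K]

/-! ### 1. The alternating identity `Σ_b (-1)^b b C(n,b) = 0` (`n ≥ 2`) and the two vanishing pairings -/

/-- `Σ_{b ≤ n} (-1)^b C(n,b) = 0` in any field, `n ≥ 1`. -/
lemma altSum_choose {n : ℕ} (hn : 1 ≤ n) : ∑ b ∈ Finset.range (n + 1), (-1 : K) ^ b * (n.choose b : K) = 0 := by
  have h := add_pow (-1 : K) 1 n
  rw [neg_add_cancel, zero_pow (by omega)] at h
  rw [h]
  exact Finset.sum_congr rfl fun j _ => by rw [one_pow, mul_one]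

/-- `Σ_{b ≤ n} (-1)^b b C(n,b) = 0` in any field, `n ≥ 2` (`b C(n,b) = n C(n-1,b-1)`). -/
lemma altSum_mul_choose {n : ℕ} (hn : 2 ≤ n) :
    ∑ b ∈ Finset.range (n + 1), (-1 : K) ^ b * (b : K) * (n.choose b : K) = 0 := by
  obtain ⟨m, rfl⟩ : ∃ m, n = m + 1 := ⟨n - 1, by omega⟩
  rw [Finset.sum_range_succ']
  simp only [Nat.cast_zero, mul_zero, zero_mul, add_zero]
  have h : ∀ b ∈ Finset.range (m + 1), (-1 : K) ^ (b + 1) * ((b + 1 : ℕ) : K) * ((m + 1).choose (b + 1) : K) =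
      -(((m + 1 : ℕ) : K) * ((-1 : K) ^ b * (m.choose b : K))) := by
    intro b _
    have hc : ((b + 1 : ℕ) : K) * ((m + 1).choose (b + 1) : K) = ((m + 1 : ℕ) : K) * (m.choose b : K) := by
      rw [← Nat.cast_mul, ← Nat.cast_mul, mul_comm (b + 1), ← Nat.add_one_mul_choose_eq m b]
    rw [pow_succ, mul_assoc, hc]
    ring
  rw [Finset.sum_congr rfl h, Finset.sum_neg_distrib, ← Finset.mul_sum, altSum_choose (by omega), mul_zero, neg_zero]

/-- `e'_λ · g_λ = λⁿ Σ_b (-1)^b b C(n,b) = 0` (`n ≥ 2`). -/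
lemma altBinomDeriv_dotProduct_geom {n : ℕ} (hn : 2 ≤ n) (la : K) :
    (fun b : Fin (n + 1) => (-1 : K) ^ (b : ℕ) * (n.choose (b : ℕ) : K) * (b : K) * la ^ (b : ℕ)) ⬝ᵥ
        (fun a : Fin (n + 1) => la ^ (n - (a : ℕ))) = 0 := by
  have h : ∀ b : Fin (n + 1), (-1 : K) ^ (b : ℕ) * (n.choose (b : ℕ) : K) * (b : K) * la ^ (b : ℕ) * la ^ (n - (b : ℕ)) =
      la ^ n * ((-1 : K) ^ (b : ℕ) * ((b : ℕ) : K) * (n.choose (b : ℕ) : K)) := by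
    intro b
    have hb := b.2
    rw [mul_assoc _ (la ^ (b : ℕ)), ← pow_add, show (b : ℕ) + (n - (b : ℕ)) = n by omega]
    ring
  rw [dotProduct, Finset.sum_congr rfl (fun b _ => h b), ← Finset.mul_sum,
    Fin.sum_univ_eq_sum_range (fun b => (-1 : K) ^ b * (b : K) * (n.choose b : K)) (n + 1), altSum_mul_choose hn, mul_zero]

/-- `e_λ · g̃ = 0` (`n ≥ 2`), `g̃_a = (A + B(n-a)) λ^{n-a}`. -/
lemma altBinom_dotProduct_conf {n : ℕ} (hn : 2 ≤ n) (A B la : K) :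
    (fun b : Fin (n + 1) => (-1 : K) ^ (b : ℕ) * (n.choose (b : ℕ) : K) * la ^ (b : ℕ)) ⬝ᵥ
        (fun a : Fin (n + 1) => (A + B * (((n - (a : ℕ) : ℕ) : K))) * la ^ (n - (a : ℕ))) = 0 := by
  have h : ∀ b : Fin (n + 1), (-1 : K) ^ (b : ℕ) * (n.choose (b : ℕ) : K) * la ^ (b : ℕ) *
      ((A + B * (((n - (b : ℕ) : ℕ) : K))) * la ^ (n - (b : ℕ))) =
      la ^ n * ((A + B * (n : K)) * ((-1 : K) ^ (b : ℕ) * (n.choose (b : ℕ) : K)) -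
        B * ((-1 : K) ^ (b : ℕ) * ((b : ℕ) : K) * (n.choose (b : ℕ) : K))) := by
    intro b
    have hb := b.2
    rw [Nat.cast_sub (by omega), show (-1 : K) ^ (b : ℕ) * (n.choose (b : ℕ) : K) * la ^ (b : ℕ) *
      ((A + B * ((n : K) - ((b : ℕ) : K))) * la ^ (n - (b : ℕ))) =
      (la ^ (b : ℕ) * la ^ (n - (b : ℕ))) * ((-1 : K) ^ (b : ℕ) * (n.choose (b : ℕ) : K) * (A + B * ((n : K) - ((b : ℕ) : K)))) by ring,
      ← pow_add, show (b : ℕ) + (n - (b : ℕ)) = n by omega]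
    ring
  rw [dotProduct, Finset.sum_congr rfl (fun b _ => h b), ← Finset.mul_sum, Finset.sum_sub_distrib, ← Finset.mul_sum, ← Finset.mul_sum,
    Fin.sum_univ_eq_sum_range (fun b => (-1 : K) ^ b * (n.choose b : K)) (n + 1),
    Fin.sum_univ_eq_sum_range (fun b => (-1 : K) ^ b * (b : K) * (n.choose b : K)) (n + 1), altSum_choose (by omega),
    altSum_mul_choose hn, mul_zero, mul_zero, sub_zero, mul_zero]

/-! ### 2. `T_f` and `M_f` on a vector for the confluent sequence -/

/-- **`T_f v = (e_λ·v) g̃ + B (e'_λ·v) g_λ`** for `q_m = (A + B m) λ^m`. [cite: BourbakiAlgebre1a3, Ch. III §8] -/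
theorem hankelT_confluent_mulVec (n : ℕ) (A B la : K) (v : Fin (n + 1) → K) :
    (hankelT n (fun m => (A + B * (m : K)) * la ^ m)) *ᵥ v =
      ((fun b : Fin (n + 1) => (-1 : K) ^ (b : ℕ) * (n.choose (b : ℕ) : K) * la ^ (b : ℕ)) ⬝ᵥ v) •
          (fun a : Fin (n + 1) => (A + B * (((n - (a : ℕ) : ℕ) : K))) * la ^ (n - (a : ℕ))) +
        (B * ((fun b : Fin (n + 1) => (-1 : K) ^ (b : ℕ) * (n.choose (b : ℕ) : K) * (b : K) * la ^ (b : ℕ)) ⬝ᵥ v)) •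
          (fun a : Fin (n + 1) => la ^ (n - (a : ℕ))) := by
  ext a
  have ha := a.2
  simp only [mulVec, dotProduct, hankelT, Pi.add_apply, Pi.smul_apply, smul_eq_mul, Finset.mul_sum, Finset.sum_mul,
    ← Finset.sum_add_distrib]
  refine Finset.sum_congr rfl fun b _ => ?_
  rw [pow_add, Nat.cast_add, Nat.cast_sub (by omega)]
  ring

/-- **`M_f v = ((-1)ⁿ B (e'_λ·g̃)(e_λ·v)) · g_λ`** (`n ≥ 2`) for `q_m = (A + B m) λ^m`: `M_f = (-1)ⁿ T_f²` has rank `≤ 1`, with image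
the line of `g_λ`, and kills `g_λ` (`e_λ·g_λ = 0`). [cite: BourbakiAlgebre1a3, Ch. III §8] -/
theorem middleM_confluent_mulVec {n : ℕ} (hn : 2 ≤ n) (A B la : K) (v : Fin (n + 1) → K) :
    (middleM n (fun m => (A + B * (m : K)) * la ^ m)) *ᵥ v =
      ((-1 : K) ^ n * (B * ((fun b : Fin (n + 1) => (-1 : K) ^ (b : ℕ) * (n.choose (b : ℕ) : K) * (b : K) * la ^ (b : ℕ)) ⬝ᵥ
          (fun a : Fin (n + 1) => (A + B * (((n - (a : ℕ) : ℕ) : K))) * la ^ (n - (a : ℕ)))) *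
        ((fun b : Fin (n + 1) => (-1 : K) ^ (b : ℕ) * (n.choose (b : ℕ) : K) * la ^ (b : ℕ)) ⬝ᵥ v))) •
        (fun a : Fin (n + 1) => la ^ (n - (a : ℕ))) := by
  rw [middleM_eq_smul_hankelT_sq, smul_mulVec, ← mulVec_mulVec, hankelT_confluent_mulVec, hankelT_confluent_mulVec,
    dotProduct_add, dotProduct_add, dotProduct_smul, dotProduct_smul, dotProduct_smul, dotProduct_smul,
    altBinom_dotProduct_conf hn, altBinom_dotProduct_geom_self (by omega), altBinomDeriv_dotProduct_geom hn]
  ext a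
  simp only [Pi.add_apply, Pi.smul_apply, smul_eq_mul, mul_zero, add_zero, zero_mul, zero_add]
  ring

/-! ### 3. No box locus for the confluent h-part -/

/-- **CONFLUENT h-PART, middle matrix:** `t ≠ 0`, `n ≥ 2` ⇒ `dim ker(M_f(q) − t) = 0` for `q_m = (A + B m) λ^m` (any `A, B, λ`):
pairing `M_f v = t v` with `e_λ` gives `e_λ·v = 0`, hence `M_f v = 0`, hence `v = 0`. [cite: BourbakiAlgebre1a3, Ch. III §8] -/
theorem finrank_ker_middleM_confluent {n : ℕ} (hn : 2 ≤ n) (A B la : K) {t : K} (ht0 : t ≠ 0) :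
    Module.finrank K ↥(LinearMap.ker (Matrix.toLin' (middleM n (fun m => (A + B * (m : K)) * la ^ m)) - t • LinearMap.id)) = 0 := by
  rw [Submodule.finrank_eq_zero, LinearMap.ker_eq_bot']
  intro v hv
  rw [LinearMap.sub_apply, Matrix.toLin'_apply, LinearMap.smul_apply, LinearMap.id_apply, sub_eq_zero,
    middleM_confluent_mulVec hn] at hv
  have hd := congrArg (fun w => (fun b : Fin (n + 1) => (-1 : K) ^ (b : ℕ) * (n.choose (b : ℕ) : K) * la ^ (b : ℕ)) ⬝ᵥ w) hv
  simp only [dotProduct_smul, smul_eq_mul, altBinom_dotProduct_geom_self (show 1 ≤ n by omega), mul_zero] at hd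
  -- hd : 0 = t * (e_λ · v)
  have h0 : (fun b : Fin (n + 1) => (-1 : K) ^ (b : ℕ) * (n.choose (b : ℕ) : K) * la ^ (b : ℕ)) ⬝ᵥ v = 0 :=
    (mul_eq_zero.mp hd.symm).resolve_left ht0
  rw [h0, mul_zero, mul_zero, zero_smul] at hv
  exact (smul_eq_zero.mp hv.symm).resolve_left ht0

/-! ### 4. The Hankel matrices of the confluent sequence have rank two -/

/-- **`rank H_k(q) = 2`** for `q_m = (A + B m) λ^m`, `B ≠ 0`, `λ ≠ 0`, `1 ≤ k`, `k + 1 ≤ N`: the range is the plane of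
`u = ((A + B i) λ^i)_i` and `g = (λ^i)_i`. [cite: BourbakiAlgebre1a3, Ch. III §8] -/
theorem hankel1_rank_confluent {N k : ℕ} (hk1 : 1 ≤ k) (hkN : k + 1 ≤ N) (A : K) {B la : K} (hB : B ≠ 0) (hla : la ≠ 0) :
    (Wedge.Hankel.hankel1 K N k (fun m => (A + B * (m : K)) * la ^ m)).rank = 2 := by
  classical
  set H := Wedge.Hankel.hankel1 K N k (fun m => (A + B * (m : K)) * la ^ m) with hH
  set u : Fin (k + 1) → K := fun i => (A + B * ((i : ℕ) : K)) * la ^ (i : ℕ) with hu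
  set g : Fin (k + 1) → K := fun i => la ^ (i : ℕ) with hg
  have hmul : ∀ v : Fin (N + 1 - k) → K,
      H *ᵥ v = (∑ s : Fin (N + 1 - k), la ^ (s : ℕ) * v s) • u + (B * ∑ s : Fin (N + 1 - k), ((s : ℕ) : K) * la ^ (s : ℕ) * v s) • g := by
    intro v
    ext i
    simp only [hH, Wedge.Hankel.hankel1, mulVec, dotProduct, Matrix.of_apply, hu, hg, Pi.add_apply, Pi.smul_apply, smul_eq_mul,
      Finset.mul_sum, Finset.sum_mul, ← Finset.sum_add_distrib]
    refine Finset.sum_congr rfl fun s _ => ?_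
    rw [pow_add, Nat.cast_add]
    ring
  have hcol : ∀ s₀ : Fin (N + 1 - k), H *ᵥ Pi.single s₀ 1 = (la ^ (s₀ : ℕ)) • u + (B * (((s₀ : ℕ) : K) * la ^ (s₀ : ℕ))) • g := by
    intro s₀
    rw [hmul]
    simp only [Pi.single_apply, mul_ite, mul_one, mul_zero, Finset.sum_ite_eq', Finset.mem_univ, if_true]
  have hli : LinearIndependent K ![u, g] := by
    rw [LinearIndependent.pair_iff]
    intro s t hst
    have h0 := congr_fun hst ⟨0, by omega⟩
    have h1 := congr_fun hst ⟨1, by omega⟩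
    simp only [hu, hg, Pi.add_apply, Pi.smul_apply, smul_eq_mul, Pi.zero_apply, pow_zero, pow_one, mul_one, Nat.cast_zero,
      Nat.cast_one, mul_zero, add_zero] at h0 h1
    -- h0 : s * A + t = 0 ; h1 : s * ((A + B) * la) + t * la = 0
    have h2 : (s * B) * la = 0 := by linear_combination h1 - la * h0
    have hs : s = 0 := by
      rcases mul_eq_zero.mp h2 with h3 | h3
      · exact (mul_eq_zero.mp h3).resolve_right hB
      · exact absurd h3 hla
    refine ⟨hs, ?_⟩
    rw [hs, zero_mul, zero_add] at h0
    exact h0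
  have hrange : LinearMap.range H.mulVecLin = Submodule.span K (Set.range ![u, g]) := by
    apply le_antisymm
    · rintro _ ⟨v, rfl⟩
      rw [Matrix.mulVecLin_apply, hmul]
      exact Submodule.add_mem _ (Submodule.smul_mem _ _ (Submodule.subset_span ⟨0, rfl⟩))
        (Submodule.smul_mem _ _ (Submodule.subset_span ⟨1, rfl⟩))
    · have h0 := hcol ⟨0, by omega⟩
      have h1 := hcol ⟨1, by omega⟩
      simp only [pow_zero, one_smul, Nat.cast_zero, zero_mul, mul_zero, zero_smul, add_zero, pow_one, Nat.cast_one, one_mul] at h0 h1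
      have hm0 : H *ᵥ Pi.single (⟨0, by omega⟩ : Fin (N + 1 - k)) 1 ∈ LinearMap.range H.mulVecLin := ⟨_, rfl⟩
      have hm1 : H *ᵥ Pi.single (⟨1, by omega⟩ : Fin (N + 1 - k)) 1 ∈ LinearMap.range H.mulVecLin := ⟨_, rfl⟩
      rw [h0] at hm0
      rw [h1] at hm1
      have hgm : g ∈ LinearMap.range H.mulVecLin := by
        have hc : B * la ≠ 0 := mul_ne_zero hB hla
        have hg' : (B * la) • g = (la • u + (B * la) • g) - la • u := by abel
        rw [show g = (B * la)⁻¹ • ((B * la) • g) by rw [smul_smul, inv_mul_cancel₀ hc, one_smul], hg']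
        exact Submodule.smul_mem _ _ (Submodule.sub_mem _ hm1 (Submodule.smul_mem _ _ hm0))
      rw [Submodule.span_le]
      rintro _ ⟨i, rfl⟩
      fin_cases i
      · exact hm0
      · exact hgm
  change Module.finrank K ↥(LinearMap.range H.mulVecLin) = 2
  rw [hrange, finrank_span_eq_card hli, Fintype.card_fin]

end Summit.Ventures.HSemireg.Mod4
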